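import Summits.AtomisticToContinuum.Crystallization.Theorems.GappedShellCensusCleanLimitsHaveWindowsBoxPinningB

/-!
# Box pinning, part C: the in-plane upper bound, `stub_geometricBounds`, the easy case

Registered stub `stub_geometricBounds` (T4a) of line `Sketch` of the crux `GappedShellCensus.CleanLimitsHaveWindows`
(stmt-AtomisticToContinuum-15932), continuing parts A and B.

* **In-plane upper bound** `bp_inplane_upper`: if `a' > a(1 + 1/50)` then `a' ≥ 63a/50` (gap dichotomy at the
  in-plane neighbour); two tropical layers on one side of layer `m` force the datum `D(m)` (no reversal at
  `m + 1`, layer `m + 2` within reach; `bpD_of_two_above`, `bpD_of_two_below`); no two consecutive data hold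
  (`bp_noDD`: the aligned layers `m, m + 3` would be closer than `a(1 - 1/50)`), so some layer has
  `¬D(m) ∧ ¬D(m - 2)` (`bp_exists_good`) and its index shell has at most `1 + 4 + 1 + 4 < 12` indices.
* `stub_geometricBounds` (hypotheses verbatim from `stub_boxPinning`): `a(1 - 1/50) ≤ a' ≤ a(1 + 1/50)` and
  `(a(1 - 1/50))² ≤ a'²/3 + (z(m+1) - z m)² ≤ (a(1 + 1/50))²` for every `m`; only the gapped-twelve clause is used.
* `bp_easyCase`: parameters already in the box of stmt-11779 give the layered hull element `A(S(a', s, z)) = Z - v`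
  (`LayeredHull.rec_hull_translate`).
* Bookkeeping for the energetic remainder (zero mean stress): `bp_meanStress_le`, `bp_noUniformGain`.
-/

noncomputable section

namespace Summit.AtomisticToContinuum.Crystallization.Theorems.CleanHull

open Filter Literature.MathematicalPhysics.StatisticalMechanics Literature.Geometry.DiscreteGeometry

/-! ## The in-plane upper bound -/

/-- Two tropical layers above `m` within reach force the datum `D(m)`: no reversal at `m + 1` and layer
`m + 2` tropically within reach of layer `m`. [folklore] -/
theorem bpD_of_two_above {a a' : ℝ} {s : ℤ → ℤ} {z : ℤ → ℝ} (ha : 0 < a) (hbig : a * (63 / 50) ≤ a')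
    (hs : IsHaggSeq s) (hzm : StrictMono z)
    (hgapI : ∀ t t' : ℤ × ℤ × ℤ, t ≠ t' → a * (1 - 1 / 50) ≤ ‖bpVec a' s z t t'‖) {m : ℤ}
    {t₁ t₂ : ℤ × ℤ × ℤ} (h₁ : t₁ ∈ bpJBp a a' s z m) (h₂ : t₂ ∈ bpJBp a a' s z m) (hne : t₁.1 ≠ t₂.1) :
    (s (m + 1) = s m ∧ a' ^ 2 / 3 + (z (m + 2) - z m) ^ 2 ≤ (a * (1 + 1 / 50)) ^ 2) := by
  -- the higher of the two layers is `≥ m + 2` and tropically within reach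
  have key : ∀ t ∈ bpJBp a a' s z m, m + 2 ≤ t.1 →
      (s (m + 1) = s m ∧ a' ^ 2 / 3 + (z (m + 2) - z m) ^ 2 ≤ (a * (1 + 1 / 50)) ^ 2) := by
    rintro ⟨m', i, j⟩ ⟨⟨hne', hd⟩, hm', hF⟩ h2
    simp only at hm' hF h2
    have hsq := pow_le_pow_left₀ (norm_nonneg _) hd 2
    rw [bp_normSq_bpVec] at hsq
    simp only [sub_zero, hF, Int.cast_ofNat] at hsq
    have hmono : z (m + 2) ≤ z m' := hzm.monotone h2
    have hpos : 0 < z (m + 2) - z m := sub_pos.2 (hzm (by omega))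
    have hreach : a' ^ 2 / 3 + (z (m + 2) - z m) ^ 2 ≤ (a * (1 + 1 / 50)) ^ 2 := by nlinarith
    refine ⟨?_, hreach⟩
    -- no reversal at `m + 1`: otherwise layer `m + 2` is aligned with layer `m` and too close
    by_contra hrev
    have hsum : s m + s (m + 1) = 0 := by
      rcases hs m with h | h <;> rcases hs (m + 1) with h' | h' <;> omega
    have hmod : (haggLabel s (m + 2) - haggLabel s m) % 3 = 0 := by
      have e1 := haggLabel_succ s m
      have e2 := haggLabel_succ s (m + 1)
      rw [show m + 1 + 1 = m + 2 by ring] at e2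
      omega
    have hal := bp_gap_aligned ha hgapI (show m ≠ m + 2 by omega) hmod
    have hbig2 : (a * (63 / 50)) ^ 2 ≤ a' ^ 2 := pow_le_pow_left₀ (by positivity) hbig 2
    nlinarith
  rcases lt_or_gt_of_ne hne with h | h
  · exact key t₂ h₂ (by have := h₁.2.1; omega)
  · exact key t₁ h₁ (by have := h₂.2.1; omega)

/-- Two tropical layers below `m` within reach force the datum `D(m - 2)`. [folklore] -/
theorem bpD_of_two_below {a a' : ℝ} {s : ℤ → ℤ} {z : ℤ → ℝ} (ha : 0 < a) (hbig : a * (63 / 50) ≤ a')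
    (hs : IsHaggSeq s) (hzm : StrictMono z)
    (hgapI : ∀ t t' : ℤ × ℤ × ℤ, t ≠ t' → a * (1 - 1 / 50) ≤ ‖bpVec a' s z t t'‖) {m : ℤ}
    {t₁ t₂ : ℤ × ℤ × ℤ} (h₁ : t₁ ∈ bpJBn a a' s z m) (h₂ : t₂ ∈ bpJBn a a' s z m) (hne : t₁.1 ≠ t₂.1) :
    (s ((m - 2) + 1) = s (m - 2) ∧ a' ^ 2 / 3 + (z ((m - 2) + 2) - z (m - 2)) ^ 2 ≤ (a * (1 + 1 / 50)) ^ 2) := by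
  have key : ∀ t ∈ bpJBn a a' s z m, t.1 ≤ m - 2 →
      (s ((m - 2) + 1) = s (m - 2) ∧ a' ^ 2 / 3 + (z ((m - 2) + 2) - z (m - 2)) ^ 2 ≤ (a * (1 + 1 / 50)) ^ 2) := by
    rintro ⟨m', i, j⟩ ⟨⟨hne', hd⟩, hm', hF⟩ h2
    simp only at hm' hF h2
    have hsq := pow_le_pow_left₀ (norm_nonneg _) hd 2
    rw [bp_normSq_bpVec] at hsq
    simp only [sub_zero, hF, Int.cast_ofNat] at hsq
    have hmono : z m' ≤ z (m - 2) := hzm.monotone h2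
    have hpos : 0 < z m - z (m - 2) := sub_pos.2 (hzm (by omega))
    have hreach : a' ^ 2 / 3 + (z (m - 2 + 2) - z (m - 2)) ^ 2 ≤ (a * (1 + 1 / 50)) ^ 2 := by
      rw [sub_add_cancel]; nlinarith
    refine ⟨?_, hreach⟩
    by_contra hrev
    rw [show m - 2 + 1 = m - 1 by ring] at hrev
    have hsum : s (m - 2) + s (m - 1) = 0 := by
      rcases hs (m - 2) with h | h <;> rcases hs (m - 1) with h' | h' <;> omega
    have hmod : (haggLabel s (m - 2) - haggLabel s m) % 3 = 0 := by
      have e1 := haggLabel_succ s (m - 2)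
      have e2 := haggLabel_succ s (m - 1)
      rw [show m - 2 + 1 = m - 1 by ring] at e1
      rw [sub_add_cancel] at e2
      omega
    have hal := bp_gap_aligned ha hgapI (show m ≠ m - 2 by omega) hmod
    have hbig2 : (a * (63 / 50)) ^ 2 ≤ a' ^ 2 := pow_le_pow_left₀ (by positivity) hbig 2
    rw [sub_add_cancel] at hreach
    nlinarith
  rcases lt_or_gt_of_ne hne with h | h
  · exact key t₁ h₁ (by have := h₂.2.1; omega)
  · exact key t₂ h₂ (by have := h₁.2.1; omega)

/-- Arithmetic of `D(m) ∧ D(m+1)`: with `X = z(m+2) - z m`, `Y = z(m+3) - z(m+1)`, `T = z(m+3) - z m ≤ X + Y`,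
the reach bounds on `X, Y`, the consecutive separations and the aligned separation `T ≥ a(1 - 1/50)` are
incompatible when `a' ≥ 63a/50`. [folklore] -/
theorem bp_arith_noDD {a α d₀ d₁ d₂ : ℝ} (hα : (a * (63 / 50)) ^ 2 / 3 ≤ α)
    (hd₀ : 0 < d₀) (hd₁ : 0 < d₁) (hd₂ : 0 < d₂)
    (hs₀ : (a * (1 - 1 / 50)) ^ 2 ≤ α + d₀ ^ 2) (hs₁ : (a * (1 - 1 / 50)) ^ 2 ≤ α + d₁ ^ 2)
    (hX : α + (d₀ + d₁) ^ 2 ≤ (a * (1 + 1 / 50)) ^ 2) (hY : α + (d₁ + d₂) ^ 2 ≤ (a * (1 + 1 / 50)) ^ 2)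
    (hT : (a * (1 - 1 / 50)) ^ 2 ≤ (d₀ + d₁ + d₂) ^ 2) : False := by
  -- first `3 α ≥ 4 (0.98 a)² - (1.02 a)²`
  have h3 : 4 * (a * (1 - 1 / 50)) ^ 2 - (a * (1 + 1 / 50)) ^ 2 ≤ 3 * α := by
    by_cases hc : (a * (1 - 1 / 50)) ^ 2 - α ≤ 0
    · nlinarith
    · have hc' : 0 < (a * (1 - 1 / 50)) ^ 2 - α := lt_of_not_ge hc
      set c := (a * (1 - 1 / 50)) ^ 2 - α with hcdef
      have h0 : Real.sqrt c ≤ d₀ := by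
        rw [← Real.sqrt_sq hd₀.le]; exact Real.sqrt_le_sqrt (by linarith)
      have h1 : Real.sqrt c ≤ d₁ := by
        rw [← Real.sqrt_sq hd₁.le]; exact Real.sqrt_le_sqrt (by linarith)
      have hsc : 0 ≤ Real.sqrt c := Real.sqrt_nonneg c
      have h4 : 4 * c ≤ (d₀ + d₁) ^ 2 := by
        have : (2 * Real.sqrt c) ^ 2 ≤ (d₀ + d₁) ^ 2 := pow_le_pow_left₀ (by positivity) (by linarith) 2
        nlinarith [Real.sq_sqrt hc'.le]
      linarith
  -- then `X², Y²` are small and `T² ≤ 2 X² + 2 Y²` is smaller than `(0.98 a)²`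
  nlinarith [sq_nonneg (d₀ + d₁ - (d₁ + d₂))]

/-- No two consecutive data `D(m)`, `D(m+1)` (regime `a' ≥ 63a/50`). [folklore] -/
theorem bp_noDD {a a' : ℝ} {s : ℤ → ℤ} {z : ℤ → ℝ} (ha : 0 < a) (hbig : a * (63 / 50) ≤ a')
    (hz : ∀ m : ℤ, 0 < z (m + 1) - z m)
    (hsep : ∀ k : ℤ, (a * (1 - 1 / 50)) ^ 2 ≤ a' ^ 2 / 3 + (z (k + 1) - z k) ^ 2)
    (hgapI : ∀ t t' : ℤ × ℤ × ℤ, t ≠ t' → a * (1 - 1 / 50) ≤ ‖bpVec a' s z t t'‖) (m : ℤ) :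
    ¬((s (m + 1) = s m ∧ a' ^ 2 / 3 + (z (m + 2) - z m) ^ 2 ≤ (a * (1 + 1 / 50)) ^ 2) ∧
      (s ((m + 1) + 1) = s (m + 1) ∧ a' ^ 2 / 3 + (z ((m + 1) + 2) - z (m + 1)) ^ 2 ≤ (a * (1 + 1 / 50)) ^ 2)) := by
  rintro ⟨⟨hs1, hX⟩, ⟨hs2, hY⟩⟩
  rw [show m + 1 + 1 = m + 2 by ring] at hs2
  have hmod : (haggLabel s (m + 3) - haggLabel s m) % 3 = 0 := by
    have e1 := haggLabel_succ s m
    have e2 := haggLabel_succ s (m + 1)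
    have e3 := haggLabel_succ s (m + 1 + 1)
    rw [show m + 1 + 1 + 1 = m + 3 by ring] at e3
    rw [show m + 1 + 1 = m + 2 by ring] at e2 e3
    omega
  have hT := bp_gap_aligned ha hgapI (show m ≠ m + 3 by omega) hmod
  have hbig2 : (a * (63 / 50)) ^ 2 ≤ a' ^ 2 := pow_le_pow_left₀ (by positivity) hbig 2
  have h0 := hz m
  have h1 := hz (m + 1)
  have h2 := hz (m + 2)
  rw [show m + 1 + 1 = m + 2 by ring] at h1
  rw [show m + 2 + 1 = m + 3 by ring] at h2
  rw [show m + 1 + 2 = m + 3 by ring] at hY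
  have hs0 := hsep m
  have hs1' := hsep (m + 1)
  rw [show m + 1 + 1 = m + 2 by ring] at hs1'
  refine bp_arith_noDD (α := a' ^ 2 / 3) (d₀ := z (m + 1) - z m) (d₁ := z (m + 2) - z (m + 1))
    (d₂ := z (m + 3) - z (m + 2)) (by linarith) h0 h1 h2 hs0 hs1' ?_ ?_ ?_
  · simpa only [show z (m + 1) - z m + (z (m + 2) - z (m + 1)) = z (m + 2) - z m by ring] using hX
  · simpa only [show z (m + 2) - z (m + 1) + (z (m + 3) - z (m + 2)) = z (m + 3) - z (m + 1) by ring]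
      using hY
  · simpa only [show z (m + 1) - z m + (z (m + 2) - z (m + 1)) + (z (m + 3) - z (m + 2)) = z (m + 3) - z m
      by ring] using hT

/-- Combinatorics: if no two consecutive integers satisfy `D`, some `m` has `¬ D m ∧ ¬ D (m - 2)`. [folklore] -/
theorem bp_exists_good (D : ℤ → Prop) (h : ∀ m, ¬(D m ∧ D (m + 1))) : ∃ m, ¬D m ∧ ¬D (m - 2) := by
  by_contra hc
  push Not at hc
  by_cases h0 : D 0
  · have h1 : ¬D 1 := fun h1 => h 0 ⟨h0, by simpa using h1⟩
    have hm1 : ¬D (-1) := fun hm1 => h (-1) ⟨hm1, by simpa using h0⟩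
    exact hm1 (by simpa using hc 1 h1)
  · have hm2 : D (-2) := by simpa using hc 0 h0
    have hm1 : ¬D (-1) := fun hm1 => h (-2) ⟨hm2, by simpa using hm1⟩
    have hm3 : ¬D (-3) := fun hm3 => h (-3) ⟨hm3, by simpa using hm2⟩
    exact hm3 (by simpa using hc (-1) hm1)

/-- **In-plane upper bound.** For `Z = v + A(S(a', s, z))` everywhere gapped-twelve at scale `a` (count on
indices, gap on indices), `a' ≤ a (1 + 1/50)`. Otherwise `a' ≥ 63a/50` by the gap dichotomy at the in-plane
neighbour; choosing a layer `m` with `¬D(m)` and `¬D(m-2)` (`bp_noDD`, `bp_exists_good`), the index shell of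
`(m, 0, 0)` consists of at most one polar index above, one below, and tropical indices in at most one layer
above and one below (`≤ 4` each): `1 + 4 + 1 + 4 < 12`. [folklore] -/
theorem bp_inplane_upper {a a' : ℝ} {s : ℤ → ℤ} {z : ℤ → ℝ} (ha : 0 < a) (ha' : 0 < a') (hs : IsHaggSeq s)
    (hz : ∀ m : ℤ, 0 < z (m + 1) - z m)
    (hgapI : ∀ t t' : ℤ × ℤ × ℤ, t ≠ t' → a * (1 - 1 / 50) ≤ ‖bpVec a' s z t t'‖ ∧
      (‖bpVec a' s z t t'‖ ≤ a * (1 + 1 / 50) ∨ a * (63 / 50) ≤ ‖bpVec a' s z t t'‖))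
    (hcountI : ∀ t₀ : ℤ × ℤ × ℤ, {t : ℤ × ℤ × ℤ | t ≠ t₀ ∧ ‖bpVec a' s z t₀ t‖ ≤ a * (1 + 1 / 50)}.ncard = 12) :
    a' ≤ a * (1 + 1 / 50) := by
  by_contra hgt
  have hgt' := not_le.1 hgt
  have hzm : StrictMono z := strictMono_int_of_lt_succ fun n => by linarith [hz n]
  have hgapI' : ∀ t t' : ℤ × ℤ × ℤ, t ≠ t' → a * (1 - 1 / 50) ≤ ‖bpVec a' s z t t'‖ :=
    fun t t' h => (hgapI t t' h).1
  -- the in-plane neighbour is at distance exactly `a'`, hence `a' ≥ 63a/50`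
  have hnorm : ‖bpVec a' s z (0, 0, 0) (0, 1, 0)‖ = a' := by
    have h2 : ‖bpVec a' s z (0, 0, 0) (0, 1, 0)‖ ^ 2 = a' ^ 2 := by
      rw [bp_normSq_bpVec]; simp [bpF]
    exact (pow_left_inj₀ (norm_nonneg _) ha'.le two_ne_zero).1 h2
  have hbig : a * (63 / 50) ≤ a' := by
    rcases (hgapI (0, 0, 0) (0, 1, 0) (by simp)).2 with h | h
    · rw [hnorm] at h; exact absurd h hgt
    · rwa [hnorm] at h
  -- consecutive separations
  have hsep : ∀ k : ℤ, (a * (1 - 1 / 50)) ^ 2 ≤ a' ^ 2 / 3 + (z (k + 1) - z k) ^ 2 := by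
    intro k
    have h := pow_le_pow_left₀ (by positivity : 0 ≤ a * (1 - 1 / 50))
      (hgapI' (k, 0, 0) (k + 1, 0, 0) (by simp)) 2
    rw [bp_normSq_bpVec] at h
    have hF : bpF (haggLabel s (k + 1) - haggLabel s k) (0 - 0) (0 - 0) = 4 := by
      rw [haggLabel_succ]; unfold bpF
      rcases hs k with h1 | h1 <;> norm_num [h1]
    rw [hF] at h
    simpa [show a' ^ 2 / 12 * (4 : ℝ) = a' ^ 2 / 3 by ring] using h
  -- a good layer
  obtain ⟨m, hDm, hDm2⟩ := bp_exists_good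
    (fun M => (s (M + 1) = s M ∧ a' ^ 2 / 3 + (z (M + 2) - z M) ^ 2 ≤ (a * (1 + 1 / 50)) ^ 2))
    (bp_noDD ha hbig hz hsep hgapI')
  have hBp : ∀ t₁ ∈ bpJBp a a' s z m, ∀ t₂ ∈ bpJBp a a' s z m, t₁.1 = t₂.1 := by
    intro t₁ h₁ t₂ h₂
    by_contra hne
    exact hDm (bpD_of_two_above ha hbig hs hzm hgapI' h₁ h₂ hne)
  have hBn : ∀ t₁ ∈ bpJBn a a' s z m, ∀ t₂ ∈ bpJBn a a' s z m, t₁.1 = t₂.1 := by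
    intro t₁ h₁ t₂ h₂
    by_contra hne
    exact hDm2 (bpD_of_two_below ha hbig hs hzm hgapI' h₁ h₂ hne)
  -- the count
  have hJ : (bpJ a a' s z m).ncard = 12 := hcountI (m, 0, 0)
  have hfin : (bpJ a a' s z m).Finite := Set.finite_of_ncard_ne_zero (by rw [hJ]; norm_num)
  have hPp : (bpJPp a a' s z m).ncard ≤ 1 :=
    (Set.ncard_le_one_iff (hfin.subset fun t ht => ht.1)).2 fun h₁ h₂ =>
      bpJPp_subsingleton ha hzm hgapI' m h₁ h₂
  have hPn : (bpJPn a a' s z m).ncard ≤ 1 :=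
    (Set.ncard_le_one_iff (hfin.subset fun t ht => ht.1)).2 fun h₁ h₂ =>
      bpJPn_subsingleton ha hzm hgapI' m h₁ h₂
  have hBp4 : (bpJBp a a' s z m).ncard ≤ 4 :=
    bp_ncard_le_four_of_sameLayer (fun t ht => ht.2.2) hBp
  have hBn4 : (bpJBn a a' s z m).ncard ≤ 4 :=
    bp_ncard_le_four_of_sameLayer (fun t ht => ht.2.2) hBn
  have hUfin : ((bpJPp a a' s z m ∪ bpJBp a a' s z m) ∪ (bpJPn a a' s z m ∪ bpJBn a a' s z m)).Finite :=
    ((hfin.subset fun t ht => ht.1).union (hfin.subset fun t ht => ht.1)).union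
      ((hfin.subset fun t ht => ht.1).union (hfin.subset fun t ht => ht.1))
  have hle := Set.ncard_le_ncard (bpJ_subset (s := s) (z := z) ha hbig m) hUfin
  have hu1 := Set.ncard_union_le (bpJPp a a' s z m ∪ bpJBp a a' s z m) (bpJPn a a' s z m ∪ bpJBn a a' s z m)
  have hu2 := Set.ncard_union_le (bpJPp a a' s z m) (bpJBp a a' s z m)
  have hu3 := Set.ncard_union_le (bpJPn a a' s z m) (bpJBn a a' s z m)
  omega

/-! ## The easy case: parameters already in the box -/

/-- **Easy case of box pinning.** If `Z = v + A(S(a', s, z))` lies in the hull of `x` and already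
`a' ∈ [47/50, 1]` with all increments in `[39a'/50, 17a'/20]`, then `A(S(a', s, z)) = Z - v` is a layered hull
element with parameters in the box (the hull is translation invariant: `LayeredHull.rec_hull_translate`).
[folklore] -/
theorem bp_easyCase (x : (N : ℕ) → (Fin N → EuclideanSpace ℝ (Fin 3))) (a' : ℝ) (ha' : 47 / 50 ≤ a')
    (ha'1 : a' ≤ 1) (A : EuclideanSpace ℝ (Fin 3) →ₗᵢ[ℝ] EuclideanSpace ℝ (Fin 3)) (s : ℤ → ℤ) (z : ℤ → ℝ)
    (v : EuclideanSpace ℝ (Fin 3)) (hs : IsHaggSeq s)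
    (hz : ∀ m : ℤ, 39 / 50 * a' ≤ z (m + 1) - z m ∧ z (m + 1) - z m ≤ 17 / 20 * a')
    (Z : Set (EuclideanSpace ℝ (Fin 3)))
    (hZ : Z = (fun p => p + v) '' {p : EuclideanSpace ℝ (Fin 3) | ∃ m i j : ℤ,
        p = A (((i : ℝ) • triangularVec₁ a') + ((j : ℝ) • triangularVec₂ a') +
          ((haggLabel s m : ℝ) • barlowOffset a') + (z m • layerNormal 1))})
    (hH : ∀ R ε : ℝ, 0 < ε → ∃ᶠ N in Filter.atTop, ∃ t : EuclideanSpace ℝ (Fin 3),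
        (∀ p ∈ Z, ‖p‖ ≤ R → ∃ i : Fin N, dist (x N i + t) p ≤ ε) ∧
        (∀ i : Fin N, ‖x N i + t‖ ≤ R → ∃ p ∈ Z, dist (x N i + t) p ≤ ε)) :
    ∃ (a'' : ℝ) (A' : EuclideanSpace ℝ (Fin 3) →ₗᵢ[ℝ] EuclideanSpace ℝ (Fin 3)) (s' : ℤ → ℤ) (z' : ℤ → ℝ),
      47 / 50 ≤ a'' ∧ a'' ≤ 1 ∧ IsHaggSeq s' ∧
      (∀ m : ℤ, 39 / 50 * a'' ≤ z' (m + 1) - z' m ∧ z' (m + 1) - z' m ≤ 17 / 20 * a'') ∧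
      ∀ R ε : ℝ, 0 < ε → ∃ᶠ N in Filter.atTop, ∃ t : EuclideanSpace ℝ (Fin 3),
        (∀ p ∈ {p : EuclideanSpace ℝ (Fin 3) | ∃ m i j : ℤ, p = A' (((i : ℝ) • triangularVec₁ a'') +
            ((j : ℝ) • triangularVec₂ a'') + ((haggLabel s' m : ℝ) • barlowOffset a'') + (z' m • layerNormal 1))},
          ‖p‖ ≤ R → ∃ i : Fin N, dist (x N i + t) p ≤ ε) ∧
        (∀ i : Fin N, ‖x N i + t‖ ≤ R → ∃ p ∈ {p : EuclideanSpace ℝ (Fin 3) | ∃ m i j : ℤ,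
            p = A' (((i : ℝ) • triangularVec₁ a'') + ((j : ℝ) • triangularVec₂ a'') +
              ((haggLabel s' m : ℝ) • barlowOffset a'') + (z' m • layerNormal 1))},
          dist (x N i + t) p ≤ ε) := by
  refine ⟨a', A, s, z, ha', ha'1, hs, hz, ?_⟩
  refine LayeredHull.rec_hull_translate x v hH ?_ ?_
  · intro p hp
    rw [hZ]
    exact ⟨p, hp, rfl⟩
  · intro q hq
    rw [hZ] at hq
    obtain ⟨p, hp, rfl⟩ := hq
    simpa using hp

/-! ## Two bookkeeping tools for the energetic remainder (zero mean stress) -/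

/-- **Zero mean stress, abstract form.** If the prism comparison "(U) for `Z` minus (L) for a competitor at
equal cardinality `n K²`" gives `K² Σ_{m ∈ [m₁, m₁+n)} (ε m - ε' m) ≤ C (n K + K²)` for all `K ≥ 1`, then
`Σ_{m ∈ [m₁, m₁+n)} (ε m - ε' m) ≤ C` (let `K → ∞`). [folklore] -/
theorem bp_meanStress_le {ε ε' : ℤ → ℝ} {C : ℝ} (m₁ : ℤ) (n : ℕ)
    (h : ∀ K : ℕ, 1 ≤ K → (K : ℝ) ^ 2 * ∑ m ∈ Finset.Ico m₁ (m₁ + n), (ε m - ε' m) ≤ C * (n * K + (K : ℝ) ^ 2)) :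
    ∑ m ∈ Finset.Ico m₁ (m₁ + n), (ε m - ε' m) ≤ C := by
  set X : ℝ := ∑ m ∈ Finset.Ico m₁ (m₁ + n), (ε m - ε' m) with hX
  by_contra hlt
  have hlt' : C < X := not_le.1 hlt
  -- choose `K` with `K (X - C) > C n`
  obtain ⟨K, hK⟩ := exists_nat_gt (max 1 (C * n / (X - C)))
  have hK1 : (1 : ℝ) ≤ K := le_trans (le_max_left _ _) hK.le
  have hK1' : 1 ≤ K := by exact_mod_cast hK1
  have hKpos : (0 : ℝ) < K := by linarith
  have h1 := h K hK1'
  -- `K² X ≤ C n K + C K²` gives `K (X - C) ≤ C n`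
  have h2 : (K : ℝ) * (X - C) ≤ C * n := by
    have : (K : ℝ) * ((K : ℝ) * (X - C)) ≤ (K : ℝ) * (C * n) := by nlinarith
    exact le_of_mul_le_mul_left this hKpos
  have h3 : C * n / (X - C) < K := lt_of_le_of_lt (le_max_right _ _) hK
  rw [div_lt_iff₀ (by linarith)] at h3
  linarith

/-- **No uniform gain.** If the layer-wise differences are uniformly `≥ c > 0` but every window sum is `≤ C`,
contradiction (take `n > C / c` layers). [folklore] -/
theorem bp_noUniformGain {d : ℤ → ℝ} {C c : ℝ} (hc : 0 < c) (hd : ∀ m, c ≤ d m)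
    (h : ∀ (m₁ : ℤ) (n : ℕ), ∑ m ∈ Finset.Ico m₁ (m₁ + n), d m ≤ C) : False := by
  obtain ⟨n, hn⟩ := exists_nat_gt (C / c)
  have h1 := h 0 n
  have h2 : (n : ℝ) * c ≤ ∑ m ∈ Finset.Ico (0 : ℤ) (0 + n), d m := by
    have := Finset.card_nsmul_le_sum (Finset.Ico (0 : ℤ) (0 + n)) d c fun m _ => hd m
    simpa using this
  rw [div_lt_iff₀ hc] at hn
  linarith

/-! ## The geometric box bounds, assembled (hypotheses verbatim from the stub) -/

/-- **Geometric box bounds of a clean exactly layered set.** If `Z = v + A(S(a', s, z))` (`a' > 0`, Hägg word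
`s`, increasing heights) is everywhere clean at scale `a ≥ 47/50` (only the gapped-twelve clause is used), then
`a(1 - 1/50) ≤ a' ≤ a(1 + 1/50)` and every nearest interlayer bond `√(a'²/3 + (z(m+1) - z m)²)` lies in
`[a(1 - 1/50), a(1 + 1/50)]`. [folklore] -/
theorem stub_geometricBounds (a a' : ℝ) (ha : 47 / 50 ≤ a) (ha' : 0 < a')
    (A : EuclideanSpace ℝ (Fin 3) →ₗᵢ[ℝ] EuclideanSpace ℝ (Fin 3)) (s : ℤ → ℤ) (z : ℤ → ℝ)
    (v : EuclideanSpace ℝ (Fin 3)) (hs : IsHaggSeq s) (hz : ∀ m : ℤ, 0 < z (m + 1) - z m)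
    (Z : Set (EuclideanSpace ℝ (Fin 3)))
    (hZ : Z = (fun p => p + v) '' {p : EuclideanSpace ℝ (Fin 3) | ∃ m i j : ℤ,
        p = A (((i : ℝ) • triangularVec₁ a') + ((j : ℝ) • triangularVec₂ a') +
          ((haggLabel s m : ℝ) • barlowOffset a') + (z m • layerNormal 1))})
    (hclean : ∀ y ∈ Z, ({w ∈ Z | w ≠ y ∧ dist y w ≤ a * (1 + 1 / 50)}.ncard = 12 ∧
        ∀ w ∈ Z, w ≠ y → a * (1 - 1 / 50) ≤ dist y w ∧
          (dist y w ≤ a * (1 + 1 / 50) ∨ a * (63 / 50) ≤ dist y w)) ∧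
      ∃ T : Finset (EuclideanSpace ℝ (Fin 3)), (↑T : Set (EuclideanSpace ℝ (Fin 3))) =
          (fun w => a⁻¹ • (w - y)) '' {w ∈ Z | w ≠ y ∧ dist y w ≤ a * (1 + 1 / 50)} ∧
        (ShellCloseTo (1 / 5) T fccKissingPattern ∨ ShellCloseTo (1 / 5) T hcpKissingPattern)) :
    a * (1 - 1 / 50) ≤ a' ∧ a' ≤ a * (1 + 1 / 50) ∧
      ∀ m : ℤ, (a * (1 - 1 / 50)) ^ 2 ≤ a' ^ 2 / 3 + (z (m + 1) - z m) ^ 2 ∧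
        a' ^ 2 / 3 + (z (m + 1) - z m) ^ 2 ≤ (a * (1 + 1 / 50)) ^ 2 := by
  have ha0 : 0 < a := by linarith
  have hzm : StrictMono z := strictMono_int_of_lt_succ fun n => by linarith [hz n]
  have hgap : ∀ y ∈ Z, ∀ w ∈ Z, w ≠ y → a * (1 - 1 / 50) ≤ dist y w ∧
      (dist y w ≤ a * (1 + 1 / 50) ∨ a * (63 / 50) ≤ dist y w) := fun y hy => (hclean y hy).1.2
  have hcount : ∀ y ∈ Z, {w ∈ Z | w ≠ y ∧ dist y w ≤ a * (1 + 1 / 50)}.ncard = 12 :=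
    fun y hy => (hclean y hy).1.1
  have hgapI : ∀ t t' : ℤ × ℤ × ℤ, t ≠ t' → a * (1 - 1 / 50) ≤ ‖bpVec a' s z t t'‖ ∧
      (‖bpVec a' s z t t'‖ ≤ a * (1 + 1 / 50) ∨ a * (63 / 50) ≤ ‖bpVec a' s z t t'‖) :=
    fun t t' hne => bp_gapI ha'.ne' hzm hZ hgap hne
  have hcountI := bp_countI ha'.ne' hzm hZ hcount
  have h1 : a * (1 - 1 / 50) ≤ a' := bp_inplane_lower ha' hZ fun y hy w hw hne => (hgap y hy w hw hne).1
  have h2 : ∀ m : ℤ, (a * (1 - 1 / 50)) ^ 2 ≤ a' ^ 2 / 3 + (z (m + 1) - z m) ^ 2 :=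
    bp_interlayer_lower ha0.le ha' hs hZ fun y hy w hw hne => (hgap y hy w hw hne).1
  have h3 : a' ≤ a * (1 + 1 / 50) := bp_inplane_upper ha0 ha' hs hz hgapI hcountI
  exact ⟨h1, h3, fun m => ⟨h2 m, bp_interlayer_upper ha0 hs hz h1 h3 h2 hcountI m⟩⟩

end Summit.AtomisticToContinuum.Crystallization.Theorems.CleanHull

end
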